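import Mathlib.RepresentationTheory.Irreducible
import Mathlib.LinearAlgebra.Matrix.ToLin
import Mathlib.Order.SupIndep
import Literature.NumberTheory.GaloisRepresentations.InducedGaloisRep
import HarnessLib

/-!
# Systems of imprimitivity indexed by a transversal: the induced block matrix and irreducibility
# of the block (abstract part of Clifford's theorem in prime index)

Topic `NumberTheory/GaloisRepresentations`; namespace
`Literature.NumberTheory.GaloisRepresentations`.  Theorems only: **no definition and no named
fact is introduced**; only Mathlib and the tree's `indMatrix` / `dotExtend` (`InducedGaloisRep`)
are used.

Setting: a representation `π` of a group `G` on a `k`-vector space `V`, a homomorphism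
`φ : H →* G` with image `N = φ(H)`, a family `t : ι → G` meeting every left coset of `N`
(a transversal when it is moreover injective on cosets), and an `N`-stable subspace `U`
(a sub-`H`-representation `W` of `π ∘ φ`).  The three facts of the "imprimitive ⟹ induced"
half of Clifford theory that do not depend on how the decomposition `V = ⊕ᵢ π(tᵢ) U` was
obtained:

* `Representation.map_iSup_map_le_of_transversal` — `∑ᵢ π(tᵢ) U` is `G`-stable
  (`x tᵢ ∈ tⱼ N`);
* `Representation.toMatrix_eq_comp_indMatrix` — if `B (i, a) = π(tᵢ) u_a` is a basis of `V`
  (`u` a basis of `U` on which `H` acts through matrices `s(h)`), the matrix of `π(x)` in `B` IS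
  the induced block matrix `Ind(s)(x) = (ṡ(tᵢ⁻¹ x tⱼ))ᵢⱼ` of Serre §3.3 (`indMatrix`, flattened by
  `Matrix.comp`) — so `π ≅ Ind_N^G U` in matrix form, and `det(X - π(x)) = det(X - Ind(s)(x))`;
* `Representation.isIrreducible_toRepresentation_of_iSupIndep` — if `π` is irreducible,
  `t i₀ = 1` and the translates `π(tᵢ) U` sit inside an INDEPENDENT family of subspaces `Eᵢ`
  with `E_{i₀} ≤ U` (e.g. distinct eigenspaces of an operator), then `U` is an irreducible
  `H`-representation (a proper `N`-stable `U₀ < U` would generate the proper `G`-stable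
  `∑ᵢ π(tᵢ) U₀`; modular law).

They are assembled, with the eigenspaces of the intertwiner `P` of `P r P⁻¹ = r ⊗ χ`
(`CliffordTwistDichotomy`), into Clifford's theorem for a normal subgroup of PRIME index in the
companion file `CliffordInducedPrimeIndex`
(`FramedRep.exists_charpoly_eq_charpoly_comp_indMatrix_of_conj_eq_twist`, `…_of_prime`,
`exists_charpoly_eq_charpoly_induce_of_not_isIrreducible_restrictField_of_prime`).

## Not here

The general Clifford correspondence (isotypic components, inertia subgroup of arbitrary index,
Serre §8.1 Prop. 24 (b) / projective representations), and any statement producing the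
decomposition `V = ⊕ᵢ π(tᵢ) U` — this file only consumes it.

## References

* A. H. Clifford, *Representations induced in an invariant subgroup*, Ann. of Math. (2) 38
  (1937), 533–550, §§1–2, Thm. 1. [Clifford1937]
* J.-P. Serre, *Linear representations of finite groups*, GTM 42 (1977), §3.3 (Def., Thm. 11–12),
  §7.1, §8.1 Prop. 24. [SerreLinearRepresentations1977]
-/

noncomputable section

namespace Literature.NumberTheory.GaloisRepresentations

section Abstract

variable {k : Type*} [Field k] {G H : Type*} [Group G] [Group H] {V : Type*} [AddCommGroup V]
  [Module k V]

/-- **`∑ᵢ π(tᵢ) U₀` is `G`-stable.**  If `φ : H →* G`, `t : ι → G` meets every left coset of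
`φ(H)` and `U₀` is a `φ(H)`-stable subspace, then `⨆ᵢ π(tᵢ) U₀` is stable under all of `G`:
`x tᵢ = tⱼ φ(h)` for some `j`, `h`, so `π(x) π(tᵢ) U₀ = π(tⱼ) π(φ h) U₀ ≤ π(tⱼ) U₀`.
[cite: SerreLinearRepresentations1977, §3.3 Thm. 12 (proof), §7.1] -/
theorem Representation.map_iSup_map_le_of_transversal (π : _root_.Representation k G V)
    (φ : H →* G) {ι : Type*} {t : ι → G}
    (ht : Function.Surjective fun i => (t i : G ⧸ φ.range)) {U₀ : Submodule k V}
    (hU₀ : ∀ h : H, ∀ v ∈ U₀, π (φ h) v ∈ U₀) (x : G) :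
    ∀ v ∈ ⨆ i, U₀.map (π (t i)), π x v ∈ ⨆ i, U₀.map (π (t i)) := by
  have hle : (⨆ i, U₀.map (π (t i))).map (π x) ≤ ⨆ i, U₀.map (π (t i)) := by
    rw [Submodule.map_iSup, iSup_le_iff]
    intro i
    obtain ⟨j, hj⟩ := ht ((x * t i : G) : G ⧸ φ.range)
    have hmem : (t j)⁻¹ * (x * t i) ∈ φ.range := QuotientGroup.eq.mp hj
    obtain ⟨h, hh⟩ := hmem
    have hxt : x * t i = t j * φ h := by rw [hh, mul_inv_cancel_left]
    rw [← Submodule.map_comp, ← Module.End.mul_eq_comp, ← map_mul, hxt, map_mul,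
      Module.End.mul_eq_comp, Submodule.map_comp]
    refine le_trans (Submodule.map_mono ?_) (le_iSup (fun i => U₀.map (π (t i))) j)
    rintro _ ⟨u, hu, rfl⟩
    exact hU₀ h u hu
  intro v hv
  exact hle (Submodule.mem_map_of_mem hv)

/-- **The matrix of `π(x)` in a basis adapted to `V = ⊕ᵢ π(tᵢ) U` is the induced block matrix.**
Let `φ : H →* G` be injective, `t : ι → G` a transversal of `G / φ(H)`, `u : κ → V` vectors on
whose span `H` acts through the matrices `s h` (`π(φ h) u_b = ∑_c s(h)_{cb} u_c`), and `B` a basis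
of `V` indexed by `ι × κ` with `B (i, a) = π(tᵢ) u_a`.  Then the matrix of `π(x)` in `B` is
`Ind(s)(x) = (ṡ(tᵢ⁻¹ x tⱼ))ᵢⱼ` (`indMatrix`, flattened by `Matrix.comp`): `x tⱼ = t_{i₀} φ(h)`
gives `π(x) B(j, b) = ∑_c s(h)_{cb} B(i₀, c)`, and `ṡ(tᵢ⁻¹ x tⱼ) = δ_{i i₀} s(h)`.
[cite: SerreLinearRepresentations1977, §3.3 Thm. 12 (proof)] -/
theorem Representation.toMatrix_eq_comp_indMatrix (π : _root_.Representation k G V) {φ : H →* G}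
    (hφ : Function.Injective φ) {ι : Type*} [Fintype ι] [DecidableEq ι] {t : ι → G}
    (ht : Function.Bijective fun i => (t i : G ⧸ φ.range)) {κ : Type*} [Fintype κ]
    [DecidableEq κ] (u : κ → V) (s : H →* Matrix κ κ k)
    (hcol : ∀ (h : H) (b : κ), π (φ h) (u b) = ∑ c, s h c b • u c)
    (B : Module.Basis (ι × κ) k V) (hB : ∀ (i : ι) (a : κ), B (i, a) = π (t i) (u a)) (x : G) :
    LinearMap.toMatrix B B (π x) = Matrix.comp ι ι κ κ k (indMatrix φ s t x) := by
  ext ⟨i, a⟩ ⟨j, b⟩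
  -- the coset of `x tⱼ`
  obtain ⟨i₀, hi₀⟩ := ht.2 ((x * t j : G) : G ⧸ φ.range)
  have hmem : (t i₀)⁻¹ * (x * t j) ∈ φ.range := QuotientGroup.eq.mp hi₀
  obtain ⟨h, hh⟩ := hmem
  have hxB : π x (B (j, b)) = ∑ c, s h c b • B (i₀, c) := by
    rw [hB j b, ← Module.End.mul_apply, ← map_mul,
      show x * t j = t i₀ * φ h by rw [hh, mul_inv_cancel_left], map_mul, Module.End.mul_apply,
      hcol h b, map_sum]
    refine Finset.sum_congr rfl fun c _ => ?_
    rw [map_smul, hB i₀ c]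
  rw [LinearMap.toMatrix_apply, hxB, map_sum, Finsupp.finsetSum_apply]
  simp only [map_smul, Finsupp.smul_apply, Module.Basis.repr_self, Finsupp.single_apply,
    Prod.mk.injEq, smul_eq_mul, mul_ite, mul_one, mul_zero]
  rw [Matrix.comp_apply, indMatrix_apply]
  by_cases hi : i = i₀
  · subst hi
    rw [show (t i)⁻¹ * x * t j = φ h by rw [hh, mul_assoc], dotExtend_apply_map hφ]
    simp [eq_comm]
  · have hnot : (t i)⁻¹ * x * t j ∉ φ.range := by
      intro hin
      apply hi
      apply ht.1
      change (t i : G ⧸ φ.range) = (t i₀ : G ⧸ φ.range)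
      have h1 : (t i : G ⧸ φ.range) = (x * t j : G) :=
        QuotientGroup.eq.mpr (by rwa [mul_assoc] at hin)
      exact h1.trans hi₀.symm
    rw [dotExtend_of_not_mem _ _ hnot, Matrix.zero_apply]
    simp [Ne.symm hi]

/-- **The block `U` of a system of imprimitivity of an irreducible representation is an
irreducible `H`-representation.**  Let `π` be irreducible on `V`, `φ : H →* G`, `t : ι → G` meeting
every coset of `φ(H)` with `t i₀ = 1`, and `W` a non-zero sub-`H`-representation of `π ∘ φ`
(subspace `U`) such that `π(tᵢ) U ≤ Eᵢ` for an INDEPENDENT family of subspaces `(Eᵢ)` with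
`E_{i₀} ≤ U`.  Then `W` is irreducible: for a sub-`H`-representation `U₀ ≤ U` the `G`-stable
`∑ᵢ π(tᵢ) U₀` (`Representation.map_iSup_map_le_of_transversal`) is `0` (so `U₀ = 0`) or `V`, and
then `U = U ⊓ (U₀ + ∑_{i ≠ i₀} Eᵢ) = U₀ + U ⊓ ∑_{i ≠ i₀} Eᵢ = U₀` (modular law; `U ≤ E_{i₀}` is
disjoint from `∑_{i ≠ i₀} Eᵢ`). [cite: Clifford1937, Thm. 1]
[cite: SerreLinearRepresentations1977, §8.1 Prop. 24 (proof)] -/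
theorem Representation.isIrreducible_toRepresentation_of_iSupIndep
    (π : _root_.Representation k G V) (hπ : π.IsIrreducible) (φ : H →* G) {ι : Type*}
    {t : ι → G} (ht : Function.Surjective fun i => (t i : G ⧸ φ.range))
    (W : Subrepresentation (π.comp φ)) (hWb : W ≠ ⊥) (E : ι → Submodule k V) (hE : iSupIndep E)
    (hWE : ∀ i, W.toSubmodule.map (π (t i)) ≤ E i) {i₀ : ι} (hi₀ : t i₀ = 1)
    (hEW : E i₀ ≤ W.toSubmodule) : W.toRepresentation.IsIrreducible := by
  classical
  haveI := hπ
  set U : Submodule k V := W.toSubmodule with hUdef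
  have hUb : U ≠ ⊥ := fun h => hWb (Subrepresentation.toSubmodule_injective h)
  -- nontriviality of the lattice of subrepresentations of `W`
  have hbt : (⊥ : Submodule k U) ≠ ⊤ := by
    intro h
    apply hUb
    rw [eq_bot_iff]
    intro v hv
    have : (⟨v, hv⟩ : U) ∈ (⊥ : Submodule k U) := by rw [h]; exact Submodule.mem_top
    rw [Submodule.mem_bot] at this ⊢
    exact congrArg Subtype.val this
  haveI : Nontrivial (Subrepresentation W.toRepresentation) :=
    ⟨⟨⊥, ⊤, fun h => hbt (congrArg Subrepresentation.toSubmodule h)⟩⟩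
  have hmap1 : ∀ U' : Submodule k V, U'.map (π (t i₀)) = U' := fun U' => by
    rw [hi₀, map_one, Module.End.one_eq_id, Submodule.map_id]
  refine ⟨fun W₀ => ?_⟩
  -- push `W₀` into `V`
  set U₀ : Submodule k V := W₀.toSubmodule.map U.subtype with hU₀def
  have hU₀le : U₀ ≤ U := by
    rintro _ ⟨w, hw, rfl⟩
    exact w.2
  have hHU₀ : ∀ (h : H), ∀ v ∈ U₀, π (φ h) v ∈ U₀ := by
    rintro h _ ⟨w, hw, rfl⟩
    exact ⟨W.toRepresentation h w, W₀.apply_mem_toSubmodule h hw, rfl⟩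
  have hst := Representation.map_iSup_map_le_of_transversal π φ ht hHU₀
  let S : Subrepresentation π := ⟨⨆ i, U₀.map (π (t i)), fun x v hv => hst x v hv⟩
  -- `W₀` is determined by `U₀`
  have hback : ∀ w : U, (w : V) ∈ U₀ → w ∈ W₀.toSubmodule := by
    rintro w ⟨w', hw', hww'⟩
    have : w' = w := Subtype.ext hww'
    exact this ▸ hw'
  have hU₀S : U₀ ≤ ⨆ i, U₀.map (π (t i)) :=
    (hmap1 U₀).ge.trans (le_iSup (fun i => U₀.map (π (t i))) i₀)
  rcases IsSimpleOrder.eq_bot_or_eq_top S with h | h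
  · left
    have h' : (⨆ i, U₀.map (π (t i))) = ⊥ := congrArg Subrepresentation.toSubmodule h
    have hU₀ : U₀ = ⊥ := le_bot_iff.mp (hU₀S.trans h'.le)
    apply Subrepresentation.toSubmodule_injective
    change W₀.toSubmodule = ⊥
    rw [eq_bot_iff]
    intro w hw
    have : (w : V) ∈ U₀ := ⟨w, hw, rfl⟩
    rw [hU₀, Submodule.mem_bot] at this
    rw [Submodule.mem_bot]
    exact Subtype.ext this
  · right
    have h' : (⨆ i, U₀.map (π (t i))) = ⊤ := congrArg Subrepresentation.toSubmodule h
    -- `∑ π(tᵢ) U₀ ≤ U₀ + X`, `X = ∑_{i ≠ i₀} Eᵢ`, and `U ⊓ X = 0`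
    set X : Submodule k V := ⨆ (i) (_ : i ≠ i₀), E i with hXdef
    have hSle : (⨆ i, U₀.map (π (t i))) ≤ U₀ ⊔ X := by
      refine iSup_le fun i => ?_
      by_cases hi : i = i₀
      · subst hi
        rw [hmap1 U₀]
        exact le_sup_left
      · refine le_trans ?_ le_sup_right
        refine le_trans ?_ (le_iSup₂ (f := fun i (_ : i ≠ i₀) => E i) i hi)
        exact (Submodule.map_mono hU₀le).trans (hWE i)
    have hUE : U ≤ E i₀ := by
      have h1 := hWE i₀
      rwa [hmap1 U] at h1
    have hUX : X ⊓ U = ⊥ := by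
      have h1 := hE i₀
      rw [disjoint_iff] at h1
      rw [eq_bot_iff, ← h1, inf_comm]
      exact inf_le_inf_right _ hUE
    have hUeq : U ≤ U₀ := by
      have h1 : U ≤ (U₀ ⊔ X) ⊓ U := le_inf (le_top.trans (h'.ge.trans hSle)) le_rfl
      rw [sup_inf_assoc_of_le _ hU₀le, hUX, sup_bot_eq] at h1
      exact h1
    apply Subrepresentation.toSubmodule_injective
    change W₀.toSubmodule = ⊤
    rw [eq_top_iff]
    intro w _
    exact hback w (hUeq w.2)

end Abstract

end Literature.NumberTheory.GaloisRepresentations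

end
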